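import Mathlib
import HarnessLib.Audit
import Summits.PneNP.PneNP.Theorems.PstarGapOneAll
import Summits.PneNP.PneNP.Theorems.PstarGapOneAnd

/-!
# Tools for the chord endgame of the reader-graph induction (ROUND-24, item T24.17′ `GSat`, case (e)) — part 1

FRONTIER range-avoidance ladder, rung F-N3, ROUND 24 (cell `pnp-ideate`; restricted-model proof complexity — nothing here bears
on `P` versus `NP`).

Elementary facts used by `PstarChordEndgame.chord_endgame` (the two-chord endgame of memo ROUND-24-PRESEED §13 R10(p), case (e)):
AND pairs under simple overlaps; chords (`PstarChordRepair.IsChord`: both AND slots `J`-private) have disjoint pairs; with no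
private XOR slot, `(3/2)`-expansion reads `3|J| ≤ 2·Σ_f #(private AND slots of f)` (`three_card_le`); a chord forces `|J| ≥ 3`
(`three_le_card`); three chords are incompatible with a non-constant G-constraint whose monomial pairs meet every chord pair
(`no_three_chords`); the XOR values and the assignment skeleton of the explicit solution (`exists_xor_assignment`,
`exists_assignment`); leaves and coleaves of non-chords (`leaf`, `coleaf`); and the value of `PstarGapOneAll.gval` under an
indicator pattern (`gval_pattern`).
-/

set_option linter.dupNamespace false

open Finset Literature.Computability.Complexity
open Summit.PneNP.PneNP.Theorems.PstarPDT (parity)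
open Summit.PneNP.PneNP.Theorems.PstarTyped (Typed)
open Summit.PneNP.PneNP.Theorems.PstarSALevel (varSet bdry BoundaryExpanding SimpleOverlap)
open Summit.PneNP.PneNP.Theorems.PstarGapPeeling (eval_pure)
open Summit.PneNP.PneNP.Theorems.PstarGapLinearised (andPair andPair_subset_varSet)
open Summit.PneNP.PneNP.Theorems.PstarGapOneAll (gval)
open Summit.PneNP.PneNP.Theorems.PstarChordRepair (IsChord)
open Summit.PneNP.PneNP.Theorems.PstarCentreFree (vars_mem_varSet)
open Summit.PneNP.PneNP.Theorems.PstarGapOneKills (exists_other_reader eq_of_bdry mem_andPair_of_slot)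

namespace Summit.PneNP.PneNP.Theorems.PstarChordEndgameTools

variable {n m : ℕ}

/-! ## Small facts about AND pairs, simple overlaps and chords -/

/-- Membership in an AND pair. -/
theorem mem_andPair_iff (I : LocalMap 4 n m) (j : Fin m) (v : Fin n) : v ∈ andPair I j ↔ v = I.vars j 2 ∨ v = I.vars j 3 := by
  unfold PstarGapLinearised.andPair
  rw [mem_insert, mem_singleton]

/-- An AND pair has at most two elements. -/
theorem card_andPair_le (I : LocalMap 4 n m) (j : Fin m) : (andPair I j).card ≤ 2 := by
  unfold PstarGapLinearised.andPair
  exact (card_insert_le _ _).trans (by rw [card_singleton])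

/-- On a pure instance an AND pair has exactly two elements. -/
theorem card_andPair (I : LocalMap 4 n m) (hI : I.IsPure xorAndPred) (j : Fin m) : (andPair I j).card = 2 := by
  unfold PstarGapLinearised.andPair
  exact card_pair fun h => absurd (hI.2 j h) (by decide)

/-- An element of an AND pair is an AND-slot variable. -/
theorem exists_slot_of_mem_andPair (I : LocalMap 4 n m) {j : Fin m} {v : Fin n} (hv : v ∈ andPair I j) :
    ∃ s : Fin 4, 2 ≤ s.val ∧ I.vars j s = v := by
  rw [mem_andPair_iff] at hv
  rcases hv with rfl | rfl
  · exact ⟨2, by decide, rfl⟩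
  · exact ⟨3, by decide, rfl⟩

/-- **Simple overlaps**: two distinct outputs do not share two distinct variables. -/
theorem not_two_shared (I : LocalMap 4 n m) (hS : SimpleOverlap I) {j j' : Fin m} (hne : j ≠ j') {v w : Fin n} (hvw : v ≠ w)
    (hv : v ∈ varSet I j) (hv' : v ∈ varSet I j') (hw : w ∈ varSet I j) (hw' : w ∈ varSet I j') : False := by
  have h2 : 2 ≤ (varSet I j ∩ varSet I j').card := by
    have hsub : ({v, w} : Finset (Fin n)) ⊆ varSet I j ∩ varSet I j' := by
      intro u hu
      rw [mem_insert, mem_singleton] at hu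
      rcases hu with rfl | rfl
      · exact mem_inter.2 ⟨hv, hv'⟩
      · exact mem_inter.2 ⟨hw, hw'⟩
    have := card_le_card hsub
    rwa [card_pair hvw] at this
  have := hS j j' hne
  omega

/-- Distinct outputs of a pure instance with simple overlaps have distinct AND pairs; indeed no AND pair contains another. -/
theorem eq_of_andPair_subset (I : LocalMap 4 n m) (hI : I.IsPure xorAndPred) (hS : SimpleOverlap I) {j j' : Fin m}
    (h : andPair I j ⊆ andPair I j') : j = j' := by
  by_contra hne
  have h2 : I.vars j 2 ∈ andPair I j' := h (mem_andPair_of_slot I j 2 (by decide))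
  have h3 : I.vars j 3 ∈ andPair I j' := h (mem_andPair_of_slot I j 3 (by decide))
  exact not_two_shared I hS hne (fun h => absurd (hI.2 j h) (by decide)) (vars_mem_varSet I j 2)
    (andPair_subset_varSet I j' h2) (vars_mem_varSet I j 3) (andPair_subset_varSet I j' h3)

/-- The AND pair of a chord lies in the boundary of `J`. -/
theorem andPair_subset_bdry_of_isChord (I : LocalMap 4 n m) {J : Finset (Fin m)} {g : Fin m} (hg : IsChord I J g) :
    andPair I g ⊆ bdry I J := by
  intro v hv
  rw [mem_andPair_iff] at hv
  rcases hv with rfl | rfl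
  · exact hg.1
  · exact hg.2

/-- AND pairs of distinct chords are disjoint (a boundary variable has one reader). -/
theorem disjoint_andPair_of_isChord (I : LocalMap 4 n m) {J : Finset (Fin m)} {g g' : Fin m} (hg : g ∈ J) (hg' : g' ∈ J)
    (hcg : IsChord I J g) (hne : g ≠ g') : Disjoint (andPair I g) (andPair I g') := by
  rw [disjoint_left]
  intro v hv hv'
  exact hne (eq_of_bdry I (andPair_subset_bdry_of_isChord I hcg hv) hg hg' (andPair_subset_varSet I g hv)
    (andPair_subset_varSet I g' hv'))

/-! ## Counting: with no private XOR slot the boundary consists of private AND slots -/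

section Count

variable (I : LocalMap 4 n m) (J : Finset (Fin m))

/-- The `J`-private AND slots of `f`. -/
def privAnd (f : Fin m) : Finset (Fin n) := (andPair I f).filter fun v => v ∈ bdry I J

/-- At most two private AND slots. -/
theorem card_privAnd_le_two (f : Fin m) : (privAnd I J f).card ≤ 2 :=
  (card_filter_le _ _).trans (card_andPair_le I f)

/-- A non-chord has at most one private AND slot. -/
theorem card_privAnd_le_one {f : Fin m} (hf : ¬ IsChord I J f) : (privAnd I J f).card ≤ 1 := by
  by_contra hlt
  push Not at hlt
  have hsub : privAnd I J f ⊆ andPair I f := filter_subset _ _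
  have heq : privAnd I J f = andPair I f := eq_of_subset_of_card_le hsub ((card_andPair_le I f).trans hlt)
  apply hf
  have h2 : I.vars f 2 ∈ privAnd I J f := heq ▸ mem_andPair_of_slot I f 2 (by decide)
  have h3 : I.vars f 3 ∈ privAnd I J f := heq ▸ mem_andPair_of_slot I f 3 (by decide)
  exact ⟨(mem_filter.1 h2).2, (mem_filter.1 h3).2⟩

/-- An output with no private AND slot. -/
theorem privAnd_eq_empty {f : Fin m} (h2 : I.vars f 2 ∉ bdry I J) (h3 : I.vars f 3 ∉ bdry I J) : privAnd I J f = ∅ := by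
  refine eq_empty_of_forall_notMem fun v hv => ?_
  obtain ⟨hva, hvb⟩ := mem_filter.1 hv
  rw [mem_andPair_iff] at hva
  rcases hva with rfl | rfl
  · exact h2 hvb
  · exact h3 hvb

/-- **Expansion with no private XOR slot**: `3|J| ≤ 2 Σ_f #(private AND slots of f)`. -/
theorem three_card_le {r : ℕ} (hB : BoundaryExpanding r I) (hJr : J.card ≤ r)
    (hnx : ∀ g ∈ J, ∀ s : Fin 4, s.val < 2 → I.vars g s ∉ bdry I J) :
    3 * J.card ≤ 2 * ∑ f ∈ J, (privAnd I J f).card := by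
  classical
  have hexp := hB J hJr
  have hcov : bdry I J ⊆ J.biUnion (privAnd I J) := by
    intro v hv
    have hv' := hv
    unfold PstarSALevel.bdry at hv'
    rw [mem_filter, card_eq_one] at hv'
    obtain ⟨f, hf⟩ := hv'.2
    have hfm : f ∈ J.filter fun j => v ∈ varSet I j := by rw [hf]; exact mem_singleton_self f
    obtain ⟨hfJ, hvf⟩ := mem_filter.1 hfm
    unfold PstarSALevel.varSet at hvf
    obtain ⟨s, -, hs⟩ := mem_image.1 hvf
    rw [mem_biUnion]
    refine ⟨f, hfJ, mem_filter.2 ⟨?_, hv⟩⟩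
    by_cases hs2 : s.val < 2
    · exact absurd (hs ▸ hv) (hnx f hfJ s hs2)
    · push Not at hs2
      exact hs ▸ mem_andPair_of_slot I f s hs2
  have := (card_le_card hcov).trans card_biUnion_le
  omega

end Count

/-! ## The two contradictory sizes -/

/-- **A chord forces three outputs**: its XOR slots are not private, so each is read by another output of `J`, and by simple
overlaps these two readers differ. -/
theorem three_le_card (I : LocalMap 4 n m) (hI : I.IsPure xorAndPred) (hS : SimpleOverlap I) {J : Finset (Fin m)} {g : Fin m}
    (hg : g ∈ J) (hnx : ∀ g ∈ J, ∀ s : Fin 4, s.val < 2 → I.vars g s ∉ bdry I J) : 3 ≤ J.card := by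
  classical
  obtain ⟨f₀, hf₀, hf₀g, h0⟩ := exists_other_reader I hg (vars_mem_varSet I g 0) (hnx g hg 0 (by decide))
  obtain ⟨f₁, hf₁, hf₁g, h1⟩ := exists_other_reader I hg (vars_mem_varSet I g 1) (hnx g hg 1 (by decide))
  have h01 : I.vars g 0 ≠ I.vars g 1 := fun h => absurd (hI.2 g h) (by decide)
  have hff : f₀ ≠ f₁ := by
    rintro rfl
    exact not_two_shared I hS hf₀g h01 h0 (vars_mem_varSet I g 0) h1 (vars_mem_varSet I g 1)
  have hsub : ({g, f₀, f₁} : Finset (Fin m)) ⊆ J := by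
    intro j hj
    simp only [mem_insert, mem_singleton] at hj
    rcases hj with rfl | rfl | rfl
    · exact hg
    · exact hf₀
    · exact hf₁
  have hcard : ({g, f₀, f₁} : Finset (Fin m)).card = 3 := by
    rw [card_insert_of_notMem (by simp [hf₀g.symm, hf₁g.symm]), card_pair hff]
  exact hcard ▸ card_le_card hsub

/-- **No three chords.**  If three distinct chords exist, every monomial pair of `G` would have to meet three pairwise disjoint
pairs, so `G = ∅`; then `C` lies inside every chord pair, so `C = ∅`; and the G-constraint is constant. -/
theorem no_three_chords (I : LocalMap 4 n m) {J G : Finset (Fin m)} {C : Finset (Fin n)}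
    {g₁ g₂ g₃ : Fin m} (hg₁ : g₁ ∈ J) (hg₂ : g₂ ∈ J) (hg₃ : g₃ ∈ J) (hc₁ : IsChord I J g₁) (hc₂ : IsChord I J g₂)
    (hc₃ : IsChord I J g₃) (h₁₂ : g₁ ≠ g₂) (h₁₃ : g₁ ≠ g₃) (h₂₃ : g₂ ≠ g₃)
    (hnc : ∃ z z' : Fin n → Bool, gval I C G z ≠ gval I C G z')
    (hmeet : ∀ g ∈ J, IsChord I J g → ∀ π ∈ G, ¬ Disjoint (andPair I π) (andPair I g))
    (hCsub : ∀ g ∈ J, IsChord I J g → ∀ v ∈ C, v ∉ andPair I g → ∃ π ∈ G, v ∈ andPair I π) : False := by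
  classical
  have d₁₂ := disjoint_andPair_of_isChord I hg₁ hg₂ hc₁ h₁₂
  have d₁₃ := disjoint_andPair_of_isChord I hg₁ hg₃ hc₁ h₁₃
  have d₂₃ := disjoint_andPair_of_isChord I hg₂ hg₃ hc₂ h₂₃
  -- `G = ∅`
  have hG : G = ∅ := by
    refine eq_empty_of_forall_notMem fun π hπ => ?_
    obtain ⟨v₁, hv₁π, hv₁⟩ := not_disjoint_iff.1 (hmeet g₁ hg₁ hc₁ π hπ)
    obtain ⟨v₂, hv₂π, hv₂⟩ := not_disjoint_iff.1 (hmeet g₂ hg₂ hc₂ π hπ)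
    obtain ⟨v₃, hv₃π, hv₃⟩ := not_disjoint_iff.1 (hmeet g₃ hg₃ hc₃ π hπ)
    have n₁₂ : v₁ ≠ v₂ := fun h => disjoint_left.1 d₁₂ hv₁ (h ▸ hv₂)
    have n₁₃ : v₁ ≠ v₃ := fun h => disjoint_left.1 d₁₃ hv₁ (h ▸ hv₃)
    have n₂₃ : v₂ ≠ v₃ := fun h => disjoint_left.1 d₂₃ hv₂ (h ▸ hv₃)
    have hsub : ({v₁, v₂, v₃} : Finset (Fin n)) ⊆ andPair I π := by
      intro v hv
      simp only [mem_insert, mem_singleton] at hv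
      rcases hv with rfl | rfl | rfl
      · exact hv₁π
      · exact hv₂π
      · exact hv₃π
    have hcard : ({v₁, v₂, v₃} : Finset (Fin n)).card = 3 := by
      rw [card_insert_of_notMem (by simp [n₁₂, n₁₃]), card_pair n₂₃]
    have := card_le_card hsub
    have := card_andPair_le I π
    omega
  subst hG
  -- `C = ∅`
  have hC : C = ∅ := by
    refine eq_empty_of_forall_notMem fun v hv => ?_
    have hv₁ : v ∈ andPair I g₁ := by
      by_contra h
      obtain ⟨π, hπ, -⟩ := hCsub g₁ hg₁ hc₁ v hv h
      exact notMem_empty π hπ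
    have hv₂ : v ∈ andPair I g₂ := by
      by_contra h
      obtain ⟨π, hπ, -⟩ := hCsub g₂ hg₂ hc₂ v hv h
      exact notMem_empty π hπ
    exact disjoint_left.1 d₁₂ hv₁ hv₂
  subst hC
  -- the constraint is constant
  obtain ⟨z, z', hzz'⟩ := hnc
  apply hzz'
  simp [PstarGapOneAll.gval, PstarPDT.parity]

/-! ## The explicit solution with two chords -/

/-- XOR values for the two chords: prescribed sums on two different pairs, `true` elsewhere. -/
theorem exists_xor_assignment (u₁ v₁ u₂ v₂ : Fin n) (h₁ : u₁ ≠ v₁) (h₂ : u₂ ≠ v₂)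
    (hne : ¬ ((u₁ = u₂ ∨ u₁ = v₂) ∧ (v₁ = u₂ ∨ v₁ = v₂))) (y₁ y₂ : Bool) :
    ∃ x : Fin n → Bool, xor (x u₁) (x v₁) = y₁ ∧ xor (x u₂) (x v₂) = y₂ ∧
      ∀ v, v ≠ u₁ → v ≠ v₁ → v ≠ u₂ → v ≠ v₂ → x v = true := by
  classical
  set x₀ : Fin n → Bool := Function.update (fun _ => true) u₂ (!y₂) with hx₀
  have hx₀u : x₀ u₂ = !y₂ := by rw [hx₀, Function.update_self]
  have hx₀v : x₀ v₂ = true := by rw [hx₀, Function.update_of_ne h₂.symm]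
  have hx₀sum : xor (x₀ u₂) (x₀ v₂) = y₂ := by rw [hx₀u, hx₀v]; cases y₂ <;> rfl
  have hx₀other : ∀ v, v ≠ u₂ → x₀ v = true := fun v hv => by rw [hx₀, Function.update_of_ne hv]
  by_cases hv₁ : v₁ = u₂ ∨ v₁ = v₂
  · -- then `u₁` is off the second pair: adjust at `u₁`
    have hu₁ : ¬ (u₁ = u₂ ∨ u₁ = v₂) := fun h => hne ⟨h, hv₁⟩
    push Not at hu₁
    refine ⟨Function.update x₀ u₁ (xor (x₀ v₁) y₁), ?_, ?_, ?_⟩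
    · rw [Function.update_self, Function.update_of_ne h₁.symm]
      cases x₀ v₁ <;> cases y₁ <;> rfl
    · rw [Function.update_of_ne (Ne.symm hu₁.1), Function.update_of_ne (Ne.symm hu₁.2), hx₀sum]
    · intro v hvu₁ _ hvu₂ _
      rw [Function.update_of_ne hvu₁, hx₀other v hvu₂]
  · push Not at hv₁
    refine ⟨Function.update x₀ v₁ (xor (x₀ u₁) y₁), ?_, ?_, ?_⟩
    · rw [Function.update_self, Function.update_of_ne h₁]
      cases x₀ u₁ <;> cases y₁ <;> rfl
    · rw [Function.update_of_ne (Ne.symm hv₁.1), Function.update_of_ne (Ne.symm hv₁.2), hx₀sum]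
    · intro v _ hvv₁ hvu₂ _
      rw [Function.update_of_ne hvv₁, hx₀other v hvu₂]

/-- **The assignment**: prescribed pattern on `S`, prescribed values at the leaves, `x` elsewhere.  The leaves are indexed by the
outputs of `R` through an injective `ℓ`, avoid `S` and the protected variables `P` (where `x` is kept). -/
theorem exists_assignment (S On : Finset (Fin n)) (R : Finset (Fin m)) (ℓ : Fin m → Fin n) (cval : Fin m → Bool)
    (x : Fin n → Bool) (P : Finset (Fin n)) (hPS : Disjoint P S) (hPℓ : ∀ f ∈ R, ℓ f ∉ P) (hℓS : ∀ f ∈ R, ℓ f ∉ S)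
    (hℓinj : ∀ f ∈ R, ∀ f' ∈ R, ℓ f = ℓ f' → f = f') :
    ∃ z : Fin n → Bool, (∀ v ∈ S, z v = decide (v ∈ On)) ∧ (∀ v ∈ P, z v = x v) ∧ ∀ f ∈ R, z (ℓ f) = cval f := by
  classical
  refine ⟨fun v => if v ∈ S then decide (v ∈ On) else if h : ∃ f, f ∈ R ∧ ℓ f = v then cval (Classical.choose h) else x v,
    fun v hv => by simp only [hv, if_true], fun v hv => ?_, fun f hf => ?_⟩
  · have hvS : v ∉ S := fun h => disjoint_left.1 hPS hv h
    have hno : ¬ ∃ f, f ∈ R ∧ ℓ f = v := fun ⟨f, hf, hfv⟩ => hPℓ f hf (hfv ▸ hv)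
    simp only [hvS, if_false, hno, dif_neg, not_false_eq_true]
  · have hex : ∃ f', f' ∈ R ∧ ℓ f' = ℓ f := ⟨f, hf, rfl⟩
    simp only [hℓS f hf, if_false, hex, dif_pos]
    have hspec := Classical.choose_spec hex
    rw [hℓinj _ hspec.1 f hf hspec.2]

/-! ## Leaves, monomial pairs and the G-constraint under a pattern -/

/-- The leaf (private AND slot) of a non-chord output with one private AND slot. -/
def leaf (I : LocalMap 4 n m) (J : Finset (Fin m)) (f : Fin m) : Fin n := if I.vars f 2 ∈ bdry I J then I.vars f 2 else I.vars f 3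

/-- The other AND slot of such an output. -/
def coleaf (I : LocalMap 4 n m) (J : Finset (Fin m)) (f : Fin m) : Fin n :=
  if I.vars f 2 ∈ bdry I J then I.vars f 3 else I.vars f 2

/-- The value of the output in terms of leaf and coleaf. -/
theorem eval_leaf (I : LocalMap 4 n m) (hI : I.IsPure xorAndPred) (J : Finset (Fin m)) (z : Fin n → Bool) (f : Fin m) :
    I.eval z f = xor (xor (z (I.vars f 0)) (z (I.vars f 1))) (z (leaf I J f) && z (coleaf I J f)) := by
  rw [eval_pure I hI]
  unfold leaf coleaf
  by_cases h : I.vars f 2 ∈ bdry I J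
  · simp only [h, if_true]
  · simp only [h, if_false, Bool.and_comm]

/-- The leaf of a non-chord is private, the coleaf is not. -/
theorem leaf_mem_bdry (I : LocalMap 4 n m) {J : Finset (Fin m)}
    (hleaf : ∀ f ∈ J, ¬ IsChord I J f → I.vars f 2 ∈ bdry I J ∨ I.vars f 3 ∈ bdry I J) {f : Fin m} (hf : f ∈ J)
    (hfc : ¬ IsChord I J f) : leaf I J f ∈ bdry I J ∧ coleaf I J f ∉ bdry I J := by
  unfold leaf coleaf
  by_cases h : I.vars f 2 ∈ bdry I J
  · simp only [h, if_true, true_and]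
    exact fun h3 => hfc ⟨h, h3⟩
  · simp only [h, if_false, not_false_eq_true, and_true]
    exact (hleaf f hf hfc).resolve_left h

/-- The leaf is an AND-slot variable of its output. -/
theorem leaf_slot (I : LocalMap 4 n m) (J : Finset (Fin m)) (f : Fin m) : ∃ s : Fin 4, 2 ≤ s.val ∧ I.vars f s = leaf I J f := by
  unfold leaf
  by_cases h : I.vars f 2 ∈ bdry I J
  · exact ⟨2, by decide, by simp [h]⟩
  · exact ⟨3, by decide, by simp [h]⟩

/-- The coleaf is an AND-slot variable of its output. -/
theorem coleaf_slot (I : LocalMap 4 n m) (J : Finset (Fin m)) (f : Fin m) :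
    ∃ s : Fin 4, 2 ≤ s.val ∧ I.vars f s = coleaf I J f := by
  unfold coleaf
  by_cases h : I.vars f 2 ∈ bdry I J
  · exact ⟨3, by decide, by simp [h]⟩
  · exact ⟨2, by decide, by simp [h]⟩

/-- With two chords, every monomial pair of `G` has one end in each chord pair: it lies inside their union and is contained in
neither of them. -/
theorem gpair_subset (I : LocalMap 4 n m) {J G : Finset (Fin m)} {g₁ g₂ : Fin m} (hg₁ : g₁ ∈ J) (hg₂ : g₂ ∈ J)
    (hc₁ : IsChord I J g₁) (hc₂ : IsChord I J g₂) (h₁₂ : g₁ ≠ g₂)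
    (hmeet : ∀ g ∈ J, IsChord I J g → ∀ π ∈ G, ¬ Disjoint (andPair I π) (andPair I g)) {π : Fin m} (hπ : π ∈ G) :
    andPair I π ⊆ andPair I g₁ ∪ andPair I g₂ ∧ ¬ (andPair I π ⊆ andPair I g₁) ∧ ¬ (andPair I π ⊆ andPair I g₂) := by
  classical
  have d₁₂ := disjoint_andPair_of_isChord I hg₁ hg₂ hc₁ h₁₂
  obtain ⟨v₁, hv₁π, hv₁⟩ := not_disjoint_iff.1 (hmeet g₁ hg₁ hc₁ π hπ)
  obtain ⟨v₂, hv₂π, hv₂⟩ := not_disjoint_iff.1 (hmeet g₂ hg₂ hc₂ π hπ)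
  have n₁₂ : v₁ ≠ v₂ := fun h => disjoint_left.1 d₁₂ hv₁ (h ▸ hv₂)
  have hsub : ({v₁, v₂} : Finset (Fin n)) ⊆ andPair I π := by
    intro v hv
    rw [mem_insert, mem_singleton] at hv
    rcases hv with rfl | rfl
    · exact hv₁π
    · exact hv₂π
  have heq : ({v₁, v₂} : Finset (Fin n)) = andPair I π :=
    eq_of_subset_of_card_le hsub (by rw [card_pair n₁₂]; exact card_andPair_le I π)
  refine ⟨fun v hv => ?_, fun h => ?_, fun h => ?_⟩
  · rw [← heq, mem_insert, mem_singleton] at hv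
    rcases hv with rfl | rfl
    · exact mem_union_left _ hv₁
    · exact mem_union_right _ hv₂
  · exact disjoint_left.1 d₁₂ (h hv₂π) hv₂
  · exact disjoint_left.1 d₁₂ hv₁ (h hv₁π)

/-- With two chords, the linear part `C` lies inside the union of the two chord pairs. -/
theorem C_subset (I : LocalMap 4 n m) {J G : Finset (Fin m)} {C : Finset (Fin n)} {g₁ g₂ : Fin m} (hg₁ : g₁ ∈ J) (hg₂ : g₂ ∈ J)
    (hc₁ : IsChord I J g₁) (hc₂ : IsChord I J g₂) (h₁₂ : g₁ ≠ g₂)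
    (hmeet : ∀ g ∈ J, IsChord I J g → ∀ π ∈ G, ¬ Disjoint (andPair I π) (andPair I g))
    (hCsub : ∀ g ∈ J, IsChord I J g → ∀ v ∈ C, v ∉ andPair I g → ∃ π ∈ G, v ∈ andPair I π) :
    C ⊆ andPair I g₁ ∪ andPair I g₂ := by
  intro v hv
  by_cases h : v ∈ andPair I g₁
  · exact mem_union_left _ h
  · obtain ⟨π, hπ, hvπ⟩ := hCsub g₁ hg₁ hc₁ v hv h
    exact (gpair_subset I hg₁ hg₂ hc₁ hc₂ h₁₂ hmeet hπ).1 hvπ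

/-- **The G-constraint under a pattern**: if `z` realises the indicator of `On` on a set `S` containing `C` and all monomial pairs
of `G`, then `gval` is the parity of `|C ∩ On|` plus the number of monomial pairs inside `On`. -/
theorem gval_pattern (I : LocalMap 4 n m) {G : Finset (Fin m)} {C S On : Finset (Fin n)} {z : Fin n → Bool}
    (hz : ∀ v ∈ S, z v = decide (v ∈ On)) (hCS : C ⊆ S) (hGS : ∀ π ∈ G, andPair I π ⊆ S) :
    gval I C G z = xor (decide (Odd (C.filter fun v => v ∈ On).card))
      (decide (Odd (G.filter fun π => andPair I π ⊆ On).card)) := by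
  classical
  unfold PstarGapOneAll.gval PstarPDT.parity
  have hC : (C.filter fun v => z v = true) = C.filter fun v => v ∈ On := by
    refine filter_congr fun v hv => ?_
    rw [hz v (hCS hv)]
    simp
  have hG : (G.filter fun g => z (I.vars g 2) = true ∧ z (I.vars g 3) = true) = G.filter fun π => andPair I π ⊆ On := by
    refine filter_congr fun π hπ => ?_
    have h2 : I.vars π 2 ∈ S := hGS π hπ (mem_andPair_of_slot I π 2 (by decide))
    have h3 : I.vars π 3 ∈ S := hGS π hπ (mem_andPair_of_slot I π 3 (by decide))
    rw [hz _ h2, hz _ h3]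
    unfold PstarGapLinearised.andPair
    simp [insert_subset_iff]
  rw [hC, hG]

end Summit.PneNP.PneNP.Theorems.PstarChordEndgameTools
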